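import Summits.Parity.GeneralizedHardyLittlewood.Theorems.BeyondDiagonalBeatsQuarter.OffDiagLevelAP
import Literature.NumberTheory.Sieve.LargeSieveAPVariance
import HarnessLib

/-!
# Route `PrimeLevelFamEdge`, crux K_B (stmt-Parity-20343), line `diagonal_kernel_split` rev 4, plan Ω, sub-line Ω-f
# (OMEGA-BLUEPRINT v4 §3c, L7 re-homed on the large sieve) — **the character split of a level deviation:
# `levelDeviation = levelSmallPart R + levelLargePart R` (conductors `1 < cond ≤ R` / `cond > R`) and Parseval over the
# reduced classes** (the «L7-bridge», part 1 of 2; part 2 = `OffDiagLevelLargeSieve`, all moduli `h ≤ H`)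

`OffDiagLevelAP` (p640065) fixed the kernel objects of GATE G2 §(a) a8: the level sum in a residue class
`levelAPSum Q F n a = Σ_{q ∈ Q, q ≡ a (n)} F q`, its principal part `levelPrincipal Q F n = φ(n)⁻¹ Σ_{(q,n)=1} F q`
(a8P) and the deviation `levelDeviation = levelAPSum − levelPrincipal`. The line lead's blueprint v4 re-homes the
LARGE-conductor part of the deviation (a8R) on the large-sieve half of Barban–Davenport–Halberstam, typed by g11 as
`Literature.NumberTheory.Sieve.LargeSieve.sum_totient_inv_largeConductor_le'` (p646696, `LargeSieveLargeConductors`) with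
Parseval over the reduced classes `LargeSieve.sum_units_norm_sq_charComb` (`LargeSieveAPVariance`). This file is the
Summit-side adapter between the two vocabularies, one modulus `n ≥ 1` at a time:

* objects (a8S / a8R of GATE G2, reviewed): `levelSmallPart R Q F n a = φ(n)⁻¹ Σ_{χ mod n, 1 < cond χ ≤ R} χ(a⁻¹) Σ_{q∈Q} F q χ q`
  and `levelLargePart R Q F n a = φ(n)⁻¹ Σ_{χ mod n, cond χ > R} χ(a⁻¹) Σ_{q∈Q} F q χ q` (the `L_R(n,a)` of `LargeSieveAPVariance`);
* reduced class `a`: `levelAPSum_eq_charExpansion` (orthogonality), `levelCoprimeSum_eq_sum_mul_one` (the principal part is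
  the trivial-character term), `levelDeviation_eq_charExpansion` (`= φ⁻¹ Σ_{cond χ > 1} …`),
  **`levelDeviation_eq_smallPart_add_largePart`** and `levelAPSum_eq_principal_add_smallPart_add_largePart` (`1 ≤ R`;
  a8 = a8P + a8S + a8R);
* PARSEVAL: `sum_units_norm_sq_levelLargePart` (`Σ_{u ∈ (ℤ/n)ˣ} ‖levelLargePart R Q F n u‖² = φ(n)⁻¹ Σ_{cond χ > R} ‖Σ_Q F χ‖²`),
  the same for the small part and for the deviation (`sum_units_norm_sq_levelDeviation`, the BDH variance of one modulus);
* `sum_range_coprime_eq_sum_units` re-indexes the reduced classes by representatives `c < n`, `(c,n) = 1` — the form in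
  which sums over the classes of a VARIABLE modulus elaborate (part 2 sums over all `h ≤ H`).

The small part (a8S) is only NAMED here; bounding it is L8 (facts H8a/H8b) or the clean-scale mechanism. Pure finite
algebra; standard axioms. Helper toward `stub_offDiagBelowSlack_io`; closes nothing.
«The programme SEARCHES and TYPES; no claim about Landau–Siegel zeros, Theorems 1–2 of arXiv:2211.02515 or
a repaired Margin232 until a kernel theorem says so.»
-/

noncomputable section

namespace Summit.Parity.GeneralizedHardyLittlewood.Theorems.BeyondDiagonalBeatsQuarter.OffDiag

open Finset
open Literature.NumberTheory.Sieve

/-! ### The objects: small- and large-conductor parts of a level deviation (GATE G2 a8S / a8R) -/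

/-- **Small-conductor part** of the level sum in the class `a mod n` (GATE G2 a8S object): the characters of conductor
`1 < cond χ ≤ R` in the character expansion, `φ(n)⁻¹ Σ_{χ mod n, 1 < cond χ ≤ R} χ(a⁻¹)·Σ_{q ∈ Q} F(q) χ(q)`.
[cite: Davenport1980, ch. 29 (character expansion of a class sum, split by conductor) — derivation] -/
def levelSmallPart (R : ℕ) (Q : Finset ℕ) (F : ℕ → ℂ) (n : ℕ) (a : ZMod n) : ℂ :=
  ((Nat.totient n : ℂ))⁻¹ * ∑ χ : DirichletCharacter ℂ n with (1 < χ.conductor ∧ χ.conductor ≤ R),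
    χ a⁻¹ * ∑ q ∈ Q, F q * χ q

/-- **Large-conductor part** of the level sum in the class `a mod n` (GATE G2 a8R object): the characters of conductor
`cond χ > R`, `φ(n)⁻¹ Σ_{χ mod n, cond χ > R} χ(a⁻¹)·Σ_{q ∈ Q} F(q) χ(q)` — the `L_R(n,a)` of `LargeSieveAPVariance`.
[cite: Davenport1980, ch. 29 (character expansion of a class sum, split by conductor) — derivation] -/
def levelLargePart (R : ℕ) (Q : Finset ℕ) (F : ℕ → ℂ) (n : ℕ) (a : ZMod n) : ℂ :=
  ((Nat.totient n : ℂ))⁻¹ * ∑ χ : DirichletCharacter ℂ n with R < χ.conductor,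
    χ a⁻¹ * ∑ q ∈ Q, F q * χ q

section OneModulus

variable (Q : Finset ℕ) (F : ℕ → ℂ) {n : ℕ}

/-- The coprime level sum is the trivial-character sum: `Σ_{q ∈ Q, (q,n)=1} F q = Σ_{q ∈ Q} F q·χ₀(q)`. [folklore] -/
theorem levelCoprimeSum_eq_sum_mul_one : levelCoprimeSum Q F n = ∑ q ∈ Q, F q * (1 : DirichletCharacter ℂ n) q := by
  rw [levelCoprimeSum, Finset.sum_filter]
  refine Finset.sum_congr rfl fun q _ ↦ ?_
  by_cases hq : IsUnit ((q : ℕ) : ZMod n)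
  · rw [if_pos hq, MulChar.one_apply hq, mul_one]
  · rw [if_neg hq, MulChar.map_nonunit _ hq, mul_zero]

/-- For a reduced class `a`, `a⁻¹` (the `ZMod` inverse) is again a unit. [folklore] -/
theorem isUnit_inv_of_isUnit {a : ZMod n} (ha : IsUnit a) : IsUnit a⁻¹ := by
  obtain ⟨u, rfl⟩ := ha
  rw [ZMod.inv_coe_unit]
  exact Units.isUnit _

variable [NeZero n]

/-- A nontrivial Dirichlet character is exactly one of conductor `> 1` (`n ≥ 1`). [folklore] -/
theorem one_lt_conductor_iff_ne_one (χ : DirichletCharacter ℂ n) : 1 < χ.conductor ↔ χ ≠ 1 := by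
  rw [Ne, DirichletCharacter.eq_one_iff_conductor_eq_one]
  have := χ.conductor_ne_zero
  omega

/-- **Character expansion of a class sum** (orthogonality): for a reduced class `a mod n`,
`Σ_{q ∈ Q, q ≡ a (n)} F q = φ(n)⁻¹ Σ_{χ mod n} χ(a⁻¹) Σ_{q ∈ Q} F q χ q`. [cite: Davenport1980, ch. 29 — derivation] -/
theorem levelAPSum_eq_charExpansion {a : ZMod n} (ha : IsUnit a) :
    levelAPSum Q F n a =
      ((Nat.totient n : ℂ))⁻¹ * ∑ χ : DirichletCharacter ℂ n, χ a⁻¹ * ∑ q ∈ Q, F q * χ q := by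
  have hφ : (n.totient : ℂ) ≠ 0 := by exact_mod_cast (Nat.totient_pos.2 (NeZero.pos n)).ne'
  have horth : ∀ q : ℕ, ∑ χ : DirichletCharacter ℂ n, χ a⁻¹ * χ q =
      if a = (q : ZMod n) then (n.totient : ℂ) else 0 := fun q ↦
    DirichletCharacter.sum_char_inv_mul_char_eq ℂ ha (q : ZMod n)
  calc levelAPSum Q F n a
      = ∑ q ∈ Q, (if a = (q : ZMod n) then F q else 0) := by
        rw [levelAPSum, Finset.sum_filter]
        refine Finset.sum_congr rfl fun q _ ↦ ?_
        by_cases hq : (q : ZMod n) = a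
        · rw [if_pos hq, if_pos hq.symm]
        · rw [if_neg hq, if_neg fun h' ↦ hq h'.symm]
    _ = ∑ q ∈ Q, ((n.totient : ℂ))⁻¹ * (F q * ∑ χ : DirichletCharacter ℂ n, χ a⁻¹ * χ q) := by
        refine Finset.sum_congr rfl fun q _ ↦ ?_
        rw [horth q]
        split_ifs
        · field_simp
        · simp
    _ = ((n.totient : ℂ))⁻¹ * ∑ q ∈ Q, ∑ χ : DirichletCharacter ℂ n, F q * (χ a⁻¹ * χ q) := by
        rw [← Finset.mul_sum]
        congr 1
        exact Finset.sum_congr rfl fun q _ ↦ by rw [Finset.mul_sum]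
    _ = ((n.totient : ℂ))⁻¹ * ∑ χ : DirichletCharacter ℂ n, ∑ q ∈ Q, F q * (χ a⁻¹ * χ q) := by
        rw [Finset.sum_comm]
    _ = ((Nat.totient n : ℂ))⁻¹ * ∑ χ : DirichletCharacter ℂ n, χ a⁻¹ * ∑ q ∈ Q, F q * χ q := by
        congr 1
        refine Finset.sum_congr rfl fun χ _ ↦ ?_
        rw [Finset.mul_sum]
        exact Finset.sum_congr rfl fun q _ ↦ by ring

/-- The characters of conductor `≤ 1` are exactly `{χ₀}`. [folklore] -/
theorem filter_not_one_lt_conductor_eq :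
    (Finset.univ : Finset (DirichletCharacter ℂ n)).filter (fun χ ↦ ¬ 1 < χ.conductor) = {1} := by
  ext χ
  rw [Finset.mem_filter, Finset.mem_singleton, one_lt_conductor_iff_ne_one, not_not]
  exact ⟨fun h ↦ h.2, fun h ↦ ⟨Finset.mem_univ _, h⟩⟩

/-- **Character expansion of the deviation**: for a reduced class `a mod n`,
`levelDeviation Q F n a = φ(n)⁻¹ Σ_{χ mod n, cond χ > 1} χ(a⁻¹) Σ_{q ∈ Q} F q χ q` — the principal part is exactly the
trivial-character term. [cite: Davenport1980, ch. 29 — derivation] -/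
theorem levelDeviation_eq_charExpansion {a : ZMod n} (ha : IsUnit a) :
    levelDeviation Q F n a = ((Nat.totient n : ℂ))⁻¹ *
      ∑ χ : DirichletCharacter ℂ n with 1 < χ.conductor, χ a⁻¹ * ∑ q ∈ Q, F q * χ q := by
  rw [levelDeviation, levelPrincipal, levelAPSum_eq_charExpansion Q F ha, levelCoprimeSum_eq_sum_mul_one,
    ← Finset.sum_filter_add_sum_filter_not Finset.univ (fun χ : DirichletCharacter ℂ n ↦ 1 < χ.conductor),
    filter_not_one_lt_conductor_eq, Finset.sum_singleton, MulChar.one_apply (isUnit_inv_of_isUnit ha), one_mul]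
  ring

/-- **The conductor split of the deviation** (`1 ≤ R`): `levelDeviation = levelSmallPart R + levelLargePart R`.
[cite: Davenport1980, ch. 29 — derivation] -/
theorem levelDeviation_eq_smallPart_add_largePart {a : ZMod n} (ha : IsUnit a) {R : ℕ} (hR : 1 ≤ R) :
    levelDeviation Q F n a = levelSmallPart R Q F n a + levelLargePart R Q F n a := by
  rw [levelDeviation_eq_charExpansion Q F ha, levelSmallPart, levelLargePart, ← mul_add]
  congr 1
  rw [← Finset.sum_filter_add_sum_filter_not
      ((Finset.univ : Finset (DirichletCharacter ℂ n)).filter (fun χ ↦ 1 < χ.conductor))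
      (fun χ : DirichletCharacter ℂ n ↦ χ.conductor ≤ R),
    Finset.filter_filter, Finset.filter_filter]
  congr 1
  refine Finset.sum_congr (Finset.filter_congr fun χ _ ↦ ?_) fun _ _ ↦ rfl
  constructor
  · rintro ⟨-, h⟩; exact not_le.1 h
  · intro h; exact ⟨lt_of_le_of_lt hR h, not_le.2 h⟩

/-- The three-part split of a reduced class sum (`1 ≤ R`): `levelAPSum = levelPrincipal + levelSmallPart R + levelLargePart R`
(a8 = a8P + a8S + a8R of GATE G2 §(a)). [cite: Davenport1980, ch. 29 — derivation] -/
theorem levelAPSum_eq_principal_add_smallPart_add_largePart {a : ZMod n} (ha : IsUnit a) {R : ℕ} (hR : 1 ≤ R) :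
    levelAPSum Q F n a = levelPrincipal Q F n + levelSmallPart R Q F n a + levelLargePart R Q F n a := by
  rw [levelAPSum_eq_principal_add_deviation, levelDeviation_eq_smallPart_add_largePart Q F ha hR, add_assoc]

/-- **Parseval over the reduced classes** for a `φ⁻¹`-normalised character combination: for any finite family `T`
of characters mod `n`, `Σ_{u ∈ (ℤ/n)ˣ} ‖φ(n)⁻¹ Σ_{χ ∈ T} χ(u⁻¹) Σ_Q F χ‖² = φ(n)⁻¹ Σ_{χ ∈ T} ‖Σ_Q F χ‖²`.
[cite: Davenport1980, ch. 29 — derivation] -/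
theorem sum_units_norm_sq_totientInv_mul_charComb (T : Finset (DirichletCharacter ℂ n)) :
    ∑ u : (ZMod n)ˣ, ‖((Nat.totient n : ℂ))⁻¹ * ∑ χ ∈ T, χ (u : ZMod n)⁻¹ * ∑ q ∈ Q, F q * χ q‖ ^ 2 =
      ((Nat.totient n : ℝ))⁻¹ * ∑ χ ∈ T, ‖∑ q ∈ Q, F q * χ q‖ ^ 2 := by
  have hφ0 : (0 : ℝ) < n.totient := by exact_mod_cast Nat.totient_pos.2 (NeZero.pos n)
  set S : DirichletCharacter ℂ n → ℂ := fun χ ↦ ∑ q ∈ Q, F q * χ q with hSdef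
  have hpull : ∀ u : (ZMod n)ˣ, ((n.totient : ℂ))⁻¹ * ∑ χ ∈ T, χ (u : ZMod n)⁻¹ * S χ =
      ∑ χ ∈ T, χ ((u⁻¹ : (ZMod n)ˣ) : ZMod n) * (((n.totient : ℂ))⁻¹ * S χ) := by
    intro u
    rw [Finset.mul_sum]
    refine Finset.sum_congr rfl fun χ _ ↦ ?_
    rw [ZMod.inv_coe_unit]
    ring
  change ∑ u : (ZMod n)ˣ, ‖((n.totient : ℂ))⁻¹ * ∑ χ ∈ T, χ (u : ZMod n)⁻¹ * S χ‖ ^ 2 =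
    ((n.totient : ℝ))⁻¹ * ∑ χ ∈ T, ‖S χ‖ ^ 2
  simp_rw [hpull]
  rw [LargeSieve.sum_units_norm_sq_charComb T (fun χ ↦ ((n.totient : ℂ))⁻¹ * S χ)]
  simp_rw [norm_mul, mul_pow, norm_inv, Complex.norm_natCast, ← Finset.mul_sum]
  field_simp

/-- **Parseval for the large-conductor part**: `Σ_{u ∈ (ℤ/n)ˣ} ‖levelLargePart R Q F n u‖² = φ(n)⁻¹ Σ_{cond χ > R} ‖Σ_Q F χ‖²`.
[cite: Davenport1980, ch. 29 — derivation] -/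
theorem sum_units_norm_sq_levelLargePart (R : ℕ) :
    ∑ u : (ZMod n)ˣ, ‖levelLargePart R Q F n (u : ZMod n)‖ ^ 2 =
      ((Nat.totient n : ℝ))⁻¹ *
        ∑ χ : DirichletCharacter ℂ n with R < χ.conductor, ‖∑ q ∈ Q, F q * χ q‖ ^ 2 :=
  sum_units_norm_sq_totientInv_mul_charComb Q F _

/-- **Parseval for the small-conductor part**: `Σ_{u ∈ (ℤ/n)ˣ} ‖levelSmallPart R Q F n u‖² = φ(n)⁻¹ Σ_{1 < cond χ ≤ R} ‖Σ_Q F χ‖²`.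
[cite: Davenport1980, ch. 29 — derivation] -/
theorem sum_units_norm_sq_levelSmallPart (R : ℕ) :
    ∑ u : (ZMod n)ˣ, ‖levelSmallPart R Q F n (u : ZMod n)‖ ^ 2 =
      ((Nat.totient n : ℝ))⁻¹ *
        ∑ χ : DirichletCharacter ℂ n with (1 < χ.conductor ∧ χ.conductor ≤ R), ‖∑ q ∈ Q, F q * χ q‖ ^ 2 :=
  sum_units_norm_sq_totientInv_mul_charComb Q F _

/-- **Parseval for the deviation** (the Barban–Davenport–Halberstam variance over the classes of one modulus):
`Σ_{u ∈ (ℤ/n)ˣ} ‖levelDeviation Q F n u‖² = φ(n)⁻¹ Σ_{cond χ > 1} ‖Σ_Q F χ‖²`. [cite: Davenport1980, ch. 29 — derivation] -/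
theorem sum_units_norm_sq_levelDeviation :
    ∑ u : (ZMod n)ˣ, ‖levelDeviation Q F n (u : ZMod n)‖ ^ 2 =
      ((Nat.totient n : ℝ))⁻¹ *
        ∑ χ : DirichletCharacter ℂ n with 1 < χ.conductor, ‖∑ q ∈ Q, F q * χ q‖ ^ 2 := by
  rw [← sum_units_norm_sq_totientInv_mul_charComb Q F _]
  exact Finset.sum_congr rfl fun u _ ↦ by rw [levelDeviation_eq_charExpansion Q F (Units.isUnit u)]

/-- **Re-indexing the reduced classes by representatives**: for `n ≥ 1` and any `g`,
`Σ_{c < n, (c,n)=1} g(c mod n) = Σ_{u ∈ (ℤ/n)ˣ} g(u)` (the bijection `c ↦ unitOfCoprime c`). This is the form in which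
sums over the classes of a VARIABLE modulus elaborate (no `Fintype (ZMod h)ˣ` for a bound `h`). [folklore] -/
theorem sum_range_coprime_eq_sum_units {M : Type*} [AddCommMonoid M] (g : ZMod n → M) :
    ∑ c ∈ (Finset.range n).filter (fun c ↦ c.Coprime n), g (c : ZMod n) = ∑ u : (ZMod n)ˣ, g (u : ZMod n) := by
  refine Finset.sum_bij' (fun c hc ↦ ZMod.unitOfCoprime c (Finset.mem_filter.1 hc).2)
    (fun u _ ↦ (u : ZMod n).val) (fun _ _ ↦ Finset.mem_univ _) (fun u _ ↦ ?_) (fun c hc ↦ ?_) (fun u _ ↦ ?_)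
    (fun c hc ↦ ?_)
  · rw [Finset.mem_filter, Finset.mem_range]
    exact ⟨ZMod.val_lt _, ZMod.val_coe_unit_coprime u⟩
  · rw [ZMod.coe_unitOfCoprime, ZMod.val_natCast_of_lt (Finset.mem_range.1 (Finset.mem_filter.1 hc).1)]
  · ext
    rw [ZMod.coe_unitOfCoprime, ZMod.natCast_zmod_val]
  · rw [ZMod.coe_unitOfCoprime]

/-- Parseval for the large-conductor part, classes indexed by representatives `c < n`, `(c,n) = 1`.
[cite: Davenport1980, ch. 29 — derivation] -/
theorem sum_range_coprime_norm_sq_levelLargePart (R : ℕ) :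
    ∑ c ∈ (Finset.range n).filter (fun c ↦ c.Coprime n), ‖levelLargePart R Q F n (c : ZMod n)‖ ^ 2 =
      ((Nat.totient n : ℝ))⁻¹ *
        ∑ χ : DirichletCharacter ℂ n with R < χ.conductor, ‖∑ q ∈ Q, F q * χ q‖ ^ 2 := by
  rw [sum_range_coprime_eq_sum_units (g := fun x : ZMod n ↦ ‖levelLargePart R Q F n x‖ ^ 2),
    sum_units_norm_sq_levelLargePart]

end OneModulus

end Summit.Parity.GeneralizedHardyLittlewood.Theorems.BeyondDiagonalBeatsQuarter.OffDiag
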